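import Summits.QuantumFields.BalabanUV.Beta.MultiscaleRegularityOfMeanValueL2

/-!
# `Summit.QuantumFields.BalabanUV.Beta.MeanValueBinderAdapter` — engine file 16e: ADAPTERS between the shapes in which the
# mean-value binder (MV₂) of O.2 item (ii-b) is delivered and the shape files 16c∕16d consume — a «roomy» binder (radii `R ≥ 1`
# with `4R + 4 ≤ N_μ`, normalisation `R^{−d}`, as announced for co-owner beta-d4-p2's De Giorgi END) implies the consumer's
# binder (all radii with `2r + 2 ≤ N_μ`, normalisation `(2r+1)^{−d}`) by RADIUS HALVING `R = ⌊(r−1)/2⌋` and the trivial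
# small-radius case; the normalized ∕ `W·z ≤ Nz` currencies convert both ways for a constant bond weight

HONEST FRAMING (page 1 of everything in this cell).  Discharging `FlowStep.BetaPertH` would make Bałaban's ultraviolet
stability UNCONDITIONAL — a constructive-QFT result; it is NOT the continuum limit and NOT the Clay problem.  This module
discharges nothing of `BetaPertH`; it is [folklore] finite bookkeeping, kernel-checked, by the OWNER of binder row D4 (unit
`b2b-balaban-beta-an4`, gen 45).  HONEST DEPENDENCY: continuum YM on T⁴ ⇐ BetaPertH ∧ nine spine estimates (0/9 proved);
BetaPertH ⇐ (D1) ∧ (D4) ∧ CAP+tail; G-an2-4 gates asym, D1 and NE2/3/4.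

THE POINT.  Files 16c∕16d derive file 9b's datum `hreg` for `levelOp` from the mean-value binder quantified over EVERY radius `r`
with `2r + 2 ≤ N_μ` (the small radii are where the consumer's trivial case lives, so `C_MV ≥ 1`).  A kernel proof of the binder
by De Giorgi ∕ Moser iteration (co-owner beta-d4-p2's road «LATTICE-DEGIORGI-MV», announced END: «`c ≡ c₀`, `4R + 4 ≤ N_μ`, `z ≥ 0`,
`W·z ≤ Nz` on the box `dist(·,x₀) ≤ R` ⟹ `z(x₀) ≤ C_d·√(R^{−d}·Σ_{box} z²)`») naturally needs MORE ROOM around the box and a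
positive radius.  **`l2binder_of_roomy`**: such a binder (normalized currency, `R ≥ 1`, `4R + 4 ≤ N_μ`, constant `K ≥ 0`) implies
16d's (MV₂) with `C_MV = max(√(5^d), K·√(9^d))`: for `r ≤ 2` the single-term bound `z(x₀) ≤ √(Σ_{box} z²) ≤ √(5^d)·√((2r+1)^{−d}Σ z²)`;
for `r ≥ 3` apply the roomy binder at `R = ⌊(r−1)/2⌋ ≥ 1` (`4R + 4 ≤ 2r + 2 ≤ N_μ`, `box_R ⊆ box_r`, `2r + 1 ≤ 9R`).
**`wn_of_subharmonic`** (with 16d's `subharmonic_of_wn` the converse): for `c ≡ c₀` the normalized hypothesis `2d·z(x) ≤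
Σ_μ(z(x+e_μ) + z(x−e_μ))` gives `W·z ≤ Nz` at `x`, so an END stated in files 12∕14∕15's currency feeds the adapter in three lines.
**`real_sup_levelOp_inverse_le_of_roomy`**: file 16d's corollary (9b BY NAME) from the roomy binder.  So the moment a roomy ℓ²
binder lands in the kernel, O.2 item (ii-b) is CLOSED FOR THE MODEL hypothesis-free by one instantiation.

WHAT IS CERTIFIED (kernel, 0 sorry, 0 def): `wn_of_subharmonic`, `single_le_sqrt_sum_sq`, **`l2binder_of_roomy`** (ℓ², room
`4R + 4 ≤ N_μ`, `R ≥ 1`, `R^{−d}`), **`l1binder_of_roomy10`** (L¹, room `10r + 4 ≤ N_μ`, `(2r+1)^{−d}` — the announced shape of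
beta-d4-p2's `SubsolutionMeanValueL1.hMV_holds`), **`real_sup_levelOp_inverse_le_of_roomy`**, **`real_sup_levelOp_inverse_le_of_roomy10`**.  LOCATORS (shape only; ABSOLUTE RULE): [Balaban1985BackgroundPropagators] Thm 3.1 (3.42)
p. 397.  Row D4: NO class change (critical-path width 0; D4 DISCHARGE NO DATE); NOT BetaPertH, NOT continuum, NOT Clay, NOT summit
progress.
-/

open scoped BigOperators
open Finset

namespace Summit.QuantumFields.BalabanUV.Beta.MeanValueBinderAdapter

open Summit.QuantumFields.BalabanUV.Beta.BoxPoincare (Box)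
open Summit.QuantumFields.BalabanUV.Beta.MultiscaleCoerciveTorus
open Summit.QuantumFields.BalabanUV.Beta.MultiscaleDistance
open Summit.QuantumFields.BalabanUV.Beta.MultiscaleDecayBudget
open Summit.QuantumFields.BalabanUV.Beta.TorusBoxSupersolution (sum_src_const sum_tgt_const wsum_src_const wsum_tgt_const)
open Summit.QuantumFields.BalabanUV.Beta.MultiscaleRegularityOfMeanValue (real_sup_levelOp_inverse_le_of_meanValue)
open Summit.QuantumFields.BalabanUV.Beta.MultiscaleRegularityOfMeanValueL2 (real_sup_levelOp_inverse_le_of_meanValueL2)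
open Literature.MathematicalPhysics.QuantumFieldTheory.Balaban1983to89
open Literature.MathematicalPhysics.QuantumFieldTheory.Balaban1983to89.B9Thm37GluePU (bsrc btgt)
open Literature.MathematicalPhysics.QuantumFieldTheory.Balaban1983to89.B9Thm37GlueTorusCov (tblk)
open Literature.MathematicalPhysics.QuantumFieldTheory.Balaban1983to89.B9Thm37GlueTorusCovLevels (levelOp)
open B5TorusCover (UT Ctr ctrU)
open B5Leibniz121 (up dn)

noncomputable section

variable {d : ℕ} {N : Fin d → ℕ} [∀ i, NeZero (N i)]

/-! ## §1 Currencies -/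

/-- For a constant bond weight `c ≡ c₀`, the normalized hypothesis `2d·z(x) ≤ Σ_μ (z(x+e_μ) + z(x−e_μ))` gives `W(x)·z(x) ≤ (Nz)(x)`
in files 12∕14∕15's currency (converse of 16d's `subharmonic_of_wn`). [folklore] -/
theorem wn_of_subharmonic {c : UT N × Fin d → ℝ} {c₀ : ℝ} (hcc : ∀ b, c b = c₀) {z : UT N → ℝ} {x : UT N}
    (h : 2 * d * z x ≤ ∑ μ, (z (up x μ) + z (dn x μ))) :
    ((∑ b ∈ univ.filter (fun b : UT N × Fin d => btgt b = x), c b ^ 2) +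
        ∑ b ∈ univ.filter (fun b : UT N × Fin d => bsrc b = x), c b ^ 2) * z x ≤
      ((∑ b ∈ univ.filter (fun b : UT N × Fin d => btgt b = x), c b ^ 2 * z (bsrc b)) +
        ∑ b ∈ univ.filter (fun b : UT N × Fin d => bsrc b = x), c b ^ 2 * z (btgt b)) := by
  rw [sum_tgt_const hcc, sum_src_const hcc, wsum_tgt_const hcc, wsum_src_const hcc]
  rw [Finset.sum_add_distrib] at h
  have hc2 : (0 : ℝ) ≤ c₀ ^ 2 := sq_nonneg _
  have h' := mul_le_mul_of_nonneg_left h hc2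
  have e1 : c₀ ^ 2 * (2 * (d : ℝ) * z x) = ((d : ℝ) * c₀ ^ 2 + d * c₀ ^ 2) * z x := by ring
  have e2 : c₀ ^ 2 * (∑ μ, z (up x μ) + ∑ μ, z (dn x μ)) = c₀ ^ 2 * ∑ μ, z (dn x μ) + c₀ ^ 2 * ∑ μ, z (up x μ) := by ring
  rw [e1, e2] at h'
  exact h'

omit [∀ i, NeZero (N i)] in
/-- A nonnegative value at a member of a finite set is at most the ℓ² norm over the set. [folklore] -/
theorem single_le_sqrt_sum_sq {Bx : Finset (UT N)} {z : UT N → ℝ} (hz : ∀ y, 0 ≤ z y) {x₀ : UT N} (hx : x₀ ∈ Bx) :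
    z x₀ ≤ Real.sqrt (∑ x ∈ Bx, z x ^ 2) := by
  rw [← Real.sqrt_sq (hz x₀)]
  exact Real.sqrt_le_sqrt (Finset.single_le_sum (fun x _ => sq_nonneg (z x)) hx)

/-! ## §2 The roomy binder implies the consumer's binder -/

/-- **RADIUS HALVING.**  A normalized ℓ² mean-value binder valid for radii `R ≥ 1` with `4R + 4 ≤ N_μ` and normalisation `R^{−d}`
(constant `K ≥ 0`) implies file 16d's binder (MV₂) — every radius `r` with `2r + 2 ≤ N_μ`, normalisation `(2r+1)^{−d}` — with
`C_MV = max(√(5^d), K·√(9^d))` (`≥ 1`).  Small radii `r ≤ 2`: the single-term bound; `r ≥ 3`: the roomy binder at `R = ⌊(r−1)/2⌋`.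
[folklore] -/
theorem l2binder_of_roomy [NeZero d] {K : ℝ} (hK : 0 ≤ K)
    (h : ∀ (x₀ : UT N) (R : ℕ), 1 ≤ R → (∀ μ, 4 * R + 4 ≤ N μ) → ∀ z : UT N → ℝ, (∀ y, 0 ≤ z y) →
      (∀ x, dist x x₀ ≤ R → 2 * d * z x ≤ ∑ μ, (z (up x μ) + z (dn x μ))) →
      z x₀ ≤ K * Real.sqrt ((((R : ℝ)) ^ d)⁻¹ * ∑ x ∈ univ.filter (fun x : UT N => dist x x₀ ≤ R), z x ^ 2)) :
    ∀ (x₀ : UT N) (r : ℕ), (∀ μ, 2 * r + 2 ≤ N μ) → ∀ z : UT N → ℝ, (∀ y, 0 ≤ z y) →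
      (∀ x, dist x x₀ ≤ r → 2 * d * z x ≤ ∑ μ, (z (up x μ) + z (dn x μ))) →
      z x₀ ≤ max (Real.sqrt (5 ^ d)) (K * Real.sqrt (9 ^ d)) *
        Real.sqrt (((2 * r + 1 : ℝ) ^ d)⁻¹ * ∑ x ∈ univ.filter (fun x : UT N => dist x x₀ ≤ r), z x ^ 2) := by
  intro x₀ r hr z hz hsub
  set Bx := univ.filter (fun x : UT N => dist x x₀ ≤ r) with hBx
  set S := ∑ x ∈ Bx, z x ^ 2 with hS
  have hS0 : 0 ≤ S := Finset.sum_nonneg fun x _ => sq_nonneg _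
  have h2r : (0 : ℝ) < (2 * r + 1 : ℝ) ^ d := by positivity
  have hx₀ : x₀ ∈ Bx := by rw [hBx, mem_filter]; exact ⟨mem_univ _, by rw [dist_self]; positivity⟩
  -- the ℓ² norm over the box, split off the normalisation
  have hsplit : Real.sqrt S = Real.sqrt ((2 * r + 1 : ℝ) ^ d) * Real.sqrt (((2 * r + 1 : ℝ) ^ d)⁻¹ * S) := by
    rw [← Real.sqrt_mul h2r.le, ← mul_assoc, mul_inv_cancel₀ h2r.ne', one_mul]
  have hnorm0 : 0 ≤ Real.sqrt (((2 * r + 1 : ℝ) ^ d)⁻¹ * S) := Real.sqrt_nonneg _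
  by_cases hsmall : r ≤ 2
  · -- small radii: `z(x₀) ≤ √S = √((2r+1)^d)·√((2r+1)^{-d} S) ≤ √(5^d)·√(…)`
    have h5 : Real.sqrt ((2 * r + 1 : ℝ) ^ d) ≤ Real.sqrt (5 ^ d) := by
      refine Real.sqrt_le_sqrt (pow_le_pow_left₀ (by positivity) ?_ d)
      have : (r : ℝ) ≤ 2 := by exact_mod_cast hsmall
      linarith
    calc z x₀ ≤ Real.sqrt S := single_le_sqrt_sum_sq hz hx₀
      _ = Real.sqrt ((2 * r + 1 : ℝ) ^ d) * Real.sqrt (((2 * r + 1 : ℝ) ^ d)⁻¹ * S) := hsplit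
      _ ≤ Real.sqrt (5 ^ d) * Real.sqrt (((2 * r + 1 : ℝ) ^ d)⁻¹ * S) := mul_le_mul_of_nonneg_right h5 hnorm0
      _ ≤ max (Real.sqrt (5 ^ d)) (K * Real.sqrt (9 ^ d)) * Real.sqrt (((2 * r + 1 : ℝ) ^ d)⁻¹ * S) :=
          mul_le_mul_of_nonneg_right (le_max_left _ _) hnorm0
  · -- large radii: the roomy binder at `R = ⌊(r−1)/2⌋ ≥ 1`
    push Not at hsmall
    set R : ℕ := (r - 1) / 2 with hR
    have hR1 : 1 ≤ R := by omega
    have hRr : R ≤ r := by omega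
    have hroom : ∀ μ, 4 * R + 4 ≤ N μ := fun μ => by have := hr μ; omega
    have h9 : 2 * r + 1 ≤ 9 * R := by omega
    set BR := univ.filter (fun x : UT N => dist x x₀ ≤ R) with hBR
    have hsubR : ∀ x, dist x x₀ ≤ R → 2 * d * z x ≤ ∑ μ, (z (up x μ) + z (dn x μ)) := fun x hx =>
      hsub x (hx.trans (by exact_mod_cast hRr))
    have hmain := h x₀ R hR1 hroom z hz hsubR
    -- `Σ_{box_R} z² ≤ S`
    have hsum : ∑ x ∈ BR, z x ^ 2 ≤ S := by
      refine Finset.sum_le_sum_of_subset_of_nonneg (fun x hx => ?_) fun x _ _ => sq_nonneg _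
      rw [hBR, mem_filter] at hx
      rw [hBx, mem_filter]
      exact ⟨mem_univ _, hx.2.trans (by exact_mod_cast hRr)⟩
    -- `(R^d)⁻¹ ≤ 9^d · ((2r+1)^d)⁻¹`
    have hR0 : (0 : ℝ) < (R : ℝ) ^ d := by positivity
    have hinv : (((R : ℝ)) ^ d)⁻¹ ≤ (9 : ℝ) ^ d * (((2 * r + 1 : ℝ)) ^ d)⁻¹ := by
      have hle : (2 * r + 1 : ℝ) ^ d ≤ (9 * (R : ℝ)) ^ d :=
        pow_le_pow_left₀ (by positivity) (by exact_mod_cast h9) d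
      rw [mul_pow] at hle
      calc (((R : ℝ)) ^ d)⁻¹ = (9 : ℝ) ^ d * ((9 : ℝ) ^ d * (R : ℝ) ^ d)⁻¹ := by field_simp
        _ ≤ (9 : ℝ) ^ d * (((2 * r + 1 : ℝ)) ^ d)⁻¹ := by gcongr
    have hstep : Real.sqrt ((((R : ℝ)) ^ d)⁻¹ * ∑ x ∈ BR, z x ^ 2) ≤
        Real.sqrt (9 ^ d) * Real.sqrt (((2 * r + 1 : ℝ) ^ d)⁻¹ * S) := by
      rw [← Real.sqrt_mul (by positivity), ← mul_assoc]
      exact Real.sqrt_le_sqrt (mul_le_mul hinv hsum (Finset.sum_nonneg fun x _ => sq_nonneg _) (by positivity))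
    calc z x₀ ≤ K * Real.sqrt ((((R : ℝ)) ^ d)⁻¹ * ∑ x ∈ BR, z x ^ 2) := hmain
      _ ≤ K * (Real.sqrt (9 ^ d) * Real.sqrt (((2 * r + 1 : ℝ) ^ d)⁻¹ * S)) := mul_le_mul_of_nonneg_left hstep hK
      _ = K * Real.sqrt (9 ^ d) * Real.sqrt (((2 * r + 1 : ℝ) ^ d)⁻¹ * S) := by ring
      _ ≤ max (Real.sqrt (5 ^ d)) (K * Real.sqrt (9 ^ d)) * Real.sqrt (((2 * r + 1 : ℝ) ^ d)⁻¹ * S) :=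
          mul_le_mul_of_nonneg_right (le_max_right _ _) hnorm0

/-- **RADIUS SHRINKING (L¹ form, room `10r + 4 ≤ N_μ` — the announced room clause of co-owner beta-d4-p2's kernel theorem
`SubsolutionMeanValueL1.hMV_holds`).**  A normalized L¹ binder valid for radii with `10r + 4 ≤ N_μ` and normalisation
`(2r+1)^{−d}` (constant `K ≥ 0`) implies file 16c's binder (MV) for EVERY radius with `2r + 2 ≤ N_μ`, with constant
`max(11^d, K·7^d)`: for `r ≤ 5` the trivial bound `z(x₀) ≤ Σ_{box} z ≤ 11^d·(2r+1)^{−d}·Σ_{box} z`; for `r ≥ 6` the roomy binder at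
`r′ = ⌊(r−1)/5⌋ ≥ 1` (`10r′ + 4 ≤ 2r + 2 ≤ N_μ`, `box_{r′} ⊆ box_r`, `2r + 1 ≤ 7(2r′+1)`). [folklore] -/
theorem l1binder_of_roomy10 [NeZero d] {K : ℝ} (hK : 0 ≤ K)
    (h : ∀ (x₀ : UT N) (r : ℕ), (∀ μ, 10 * r + 4 ≤ N μ) → ∀ z : UT N → ℝ, (∀ y, 0 ≤ z y) →
      (∀ x, dist x x₀ ≤ r → 2 * d * z x ≤ ∑ μ, (z (up x μ) + z (dn x μ))) →
      z x₀ ≤ K / (2 * r + 1 : ℝ) ^ d * ∑ x ∈ univ.filter (fun x : UT N => dist x x₀ ≤ r), z x) :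
    ∀ (x₀ : UT N) (r : ℕ), (∀ μ, 2 * r + 2 ≤ N μ) → ∀ z : UT N → ℝ, (∀ y, 0 ≤ z y) →
      (∀ x, dist x x₀ ≤ r → 2 * d * z x ≤ ∑ μ, (z (up x μ) + z (dn x μ))) →
      z x₀ ≤ max ((11 : ℝ) ^ d) (K * 7 ^ d) / (2 * r + 1 : ℝ) ^ d *
        ∑ x ∈ univ.filter (fun x : UT N => dist x x₀ ≤ r), z x := by
  intro x₀ r hr z hz hsub
  set Bx := univ.filter (fun x : UT N => dist x x₀ ≤ r) with hBx
  set S := ∑ x ∈ Bx, z x with hS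
  have hS0 : 0 ≤ S := Finset.sum_nonneg fun x _ => hz x
  have h2r : (0 : ℝ) < (2 * r + 1 : ℝ) ^ d := by positivity
  have hx₀ : x₀ ∈ Bx := by rw [hBx, mem_filter]; exact ⟨mem_univ _, by rw [dist_self]; positivity⟩
  have hmax0 : 0 ≤ max ((11 : ℝ) ^ d) (K * 7 ^ d) := le_max_of_le_left (by positivity)
  by_cases hsmall : r ≤ 5
  · -- small radii: `z(x₀) ≤ S ≤ 11^d/(2r+1)^d · S`
    have h11 : (2 * r + 1 : ℝ) ^ d ≤ (11 : ℝ) ^ d := by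
      refine pow_le_pow_left₀ (by positivity) ?_ d
      have : (r : ℝ) ≤ 5 := by exact_mod_cast hsmall
      linarith
    have hone : (1 : ℝ) ≤ max ((11 : ℝ) ^ d) (K * 7 ^ d) / (2 * r + 1 : ℝ) ^ d := by
      rw [le_div_iff₀ h2r, one_mul]; exact h11.trans (le_max_left _ _)
    calc z x₀ ≤ S := Finset.single_le_sum (fun x _ => hz x) hx₀
      _ = 1 * S := (one_mul S).symm
      _ ≤ max ((11 : ℝ) ^ d) (K * 7 ^ d) / (2 * r + 1 : ℝ) ^ d * S := mul_le_mul_of_nonneg_right hone hS0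
  · -- large radii: the roomy binder at `r′ = ⌊(r−1)/5⌋ ≥ 1`
    push Not at hsmall
    set r' : ℕ := (r - 1) / 5 with hr'
    have hrr : r' ≤ r := by omega
    have hroom : ∀ μ, 10 * r' + 4 ≤ N μ := fun μ => by have := hr μ; omega
    have h7 : 2 * r + 1 ≤ 7 * (2 * r' + 1) := by omega
    set Br := univ.filter (fun x : UT N => dist x x₀ ≤ r') with hBr
    have hsubr : ∀ x, dist x x₀ ≤ r' → 2 * d * z x ≤ ∑ μ, (z (up x μ) + z (dn x μ)) := fun x hx =>
      hsub x (hx.trans (by exact_mod_cast hrr))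
    have hmain := h x₀ r' hroom z hz hsubr
    have hsum : ∑ x ∈ Br, z x ≤ S := by
      refine Finset.sum_le_sum_of_subset_of_nonneg (fun x hx => ?_) fun x _ _ => hz x
      rw [hBr, mem_filter] at hx
      rw [hBx, mem_filter]
      exact ⟨mem_univ _, hx.2.trans (by exact_mod_cast hrr)⟩
    have h2r' : (0 : ℝ) < (2 * r' + 1 : ℝ) ^ d := by positivity
    -- `1/(2r′+1)^d ≤ 7^d/(2r+1)^d`
    have hinv : K / (2 * r' + 1 : ℝ) ^ d ≤ K * 7 ^ d / (2 * r + 1 : ℝ) ^ d := by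
      rw [div_le_div_iff₀ h2r' h2r]
      have hle : (2 * r + 1 : ℝ) ^ d ≤ (7 * (2 * r' + 1 : ℝ)) ^ d :=
        pow_le_pow_left₀ (by positivity) (by exact_mod_cast h7) d
      rw [mul_pow] at hle
      calc K * (2 * r + 1 : ℝ) ^ d ≤ K * ((7 : ℝ) ^ d * (2 * r' + 1 : ℝ) ^ d) := mul_le_mul_of_nonneg_left hle hK
        _ = K * 7 ^ d * (2 * r' + 1 : ℝ) ^ d := by ring
    calc z x₀ ≤ K / (2 * r' + 1 : ℝ) ^ d * ∑ x ∈ Br, z x := hmain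
      _ ≤ K / (2 * r' + 1 : ℝ) ^ d * S := mul_le_mul_of_nonneg_left hsum (by positivity)
      _ ≤ K * 7 ^ d / (2 * r + 1 : ℝ) ^ d * S := mul_le_mul_of_nonneg_right hinv hS0
      _ ≤ max ((11 : ℝ) ^ d) (K * 7 ^ d) / (2 * r + 1 : ℝ) ^ d * S :=
          mul_le_mul_of_nonneg_right (div_le_div_of_nonneg_right (le_max_right _ _) h2r.le) hS0

/-! ## §3 The sup member (3.42)₁'s SHAPE for `levelOp` from a roomy kernel binder (file 16d + 9b BY NAME) -/

variable [NeZero d] {Cp J K : Type} [Fintype Cp] [DecidableEq Cp] [Nonempty Cp]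
  [Fintype J] [Fintype K] [DecidableEq K] (S : J → ℕ) (hS : ∀ l, 1 ≤ S l) (hdivS : ∀ l i, S l ∣ N i) (lvl : K → J)
  (zc : (k : K) → Ctr N (S (lvl k)))
  (hdisj : ∀ k k' v v', cellPt S hS hdivS lvl zc k v = cellPt S hS hdivS lvl zc k' v' → k = k')
  (hcover : ∀ x : UT N, ∃ k, ∃ v : Box d (S (lvl k)), cellPt S hS hdivS lvl zc k v = x)
  (Rm : UT N × Fin d → Cp → Cp → ℝ) (hRm : ∀ b i j, ∑ k, Rm b k i * Rm b k j = if i = j then (1 : ℝ) else 0)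
  (T : J → UT N → Cp → Cp → ℝ) (hT : ∀ l x i i', ∑ k, T l x k i * T l x k i' = if i = i' then (1 : ℝ) else 0)
  (a : J → ℝ) (ha : ∀ j, 0 ≤ a j) (ω : J → UT N → ℝ)
  (hsupp : ∀ l x, ω l (ctrU N (S l) (tblk (hS l) (hdivS l) x)) ≠ 0 → ∃ k v, lvl k = l ∧ cellPt S hS hdivS lvl zc k v = x)
  {amax : ℝ} (hamax : 0 ≤ amax)
  (hscale : ∀ k, a (lvl k) * ω (lvl k) (ctrU N (S (lvl k)) (zc k)) ^ 2 * (S (lvl k) : ℝ) ^ d ≤ amax / (S (lvl k) : ℝ) ^ 2)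
  (c : UT N × Fin d → ℝ) {c₀ : ℝ} (hcc : ∀ b, c b = c₀) (hc₀ : c₀ ≠ 0)
  {L : ℕ} (hL : 1 ≤ L) (e : J → ℕ) (hSe : ∀ l, S l = L ^ e l) {R : ℝ} (hR : 0 < R) {A : ℕ}
  (hadd : ∀ x y : UT N, |(e (lvl (cellOf S hS hdivS lvl zc hcover x)) : ℝ) - e (lvl (cellOf S hS hdivS lvl zc hcover y))| ≤
    A + sdist bsrc btgt (siteScale S hS hdivS lvl zc hcover) x y / R)

include hdisj hT ha hsupp hamax hscale hL e hSe hR hadd hRm hcc hc₀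

/-- **THE SUP MEMBER FOR `levelOp` FROM A ROOMY KERNEL BINDER.**  If for every centre `x₀`, radius `R′ ≥ 1` with `4R′ + 4 ≤ N_μ`
and `z ≥ 0` normalized-subharmonic on the box `dist(·,x₀) ≤ R′` one has `z(x₀) ≤ K·√(R′^{−d}·Σ_{box} z²)` (`K ≥ 0`), then file
16d's `real_sup_levelOp_inverse_le_of_meanValueL2` applies with `C_MV = max(√(5^d), K√(9^d))`: the sup member (3.42)₁'s SHAPE for
`levelOp`, sitewise and level-free — O.2 item (ii-b) for the MODEL then rests on that binder ALONE.
[cite: Balaban1985BackgroundPropagators, Thm 3.1 (3.42) p.397] [folklore] -/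
theorem real_sup_levelOp_inverse_le_of_roomy {cmax : ℝ} (hc : ∀ b, |c b| ≤ cmax) {C : ℝ}
    (hcoer : ∀ f : UT N × Cp → ℝ,
      C * ∑ k, ((S (lvl k) : ℝ) ^ 2)⁻¹ * ∑ v : Box d (S (lvl k)), ∑ i, f (cellPt S hS hdivS lvl zc k v, i) ^ 2 ≤
        ∑ p, f p * levelOp bsrc btgt c Rm (fun l x => ctrU N (S l) (tblk (hS l) (hdivS l) x))
          (fun l x => ω l (ctrU N (S l) (tblk (hS l) (hdivS l) x))) T a f p)
    {κ : ℝ} (hκ0 : 0 ≤ κ) (hκ1 : κ ≤ 1) (hμ : 0 < C - 2 * d * cmax ^ 2 * κ ^ 2 - amax * (Real.exp (2 * d * κ) - 1))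
    (hrate : (1 + d / 2) * (Real.log L / R) ≤ κ)
    {Γ θ : ℝ} (hΓ : Γ = (L : ℝ) ^ A * Real.exp (Real.log L / R * (4 * d + 1))) (hθ : θ = 1 / (4 * d * Γ)) {K₀ : ℝ}
    (hK₀ : 0 ≤ K₀)
    (hMVroomy : ∀ (x₀ : UT N) (R' : ℕ), 1 ≤ R' → (∀ μ, 4 * R' + 4 ≤ N μ) → ∀ z : UT N → ℝ, (∀ y, 0 ≤ z y) →
      (∀ x, dist x x₀ ≤ R' → 2 * d * z x ≤ ∑ μ, (z (up x μ) + z (dn x μ))) →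
      z x₀ ≤ K₀ * Real.sqrt ((((R' : ℝ)) ^ d)⁻¹ * ∑ x ∈ univ.filter (fun x : UT N => dist x x₀ ≤ R'), z x ^ 2))
    (k' : K) (u : UT N × Cp → ℝ) (hu : ∀ p, cellOf S hS hdivS lvl zc hcover p.1 ≠ k' → u p = 0)
    {m : ℝ} (hm : 0 ≤ m) (hum : ∀ p, |u p| ≤ m) (p : UT N × Cp) :
    |(Ring.inverse (levelOp bsrc btgt c Rm (fun l x => ctrU N (S l) (tblk (hS l) (hdivS l) x))
        (fun l x => ω l (ctrU N (S l) (tblk (hS l) (hdivS l) x))) T a)) u p| ≤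
      ((max (Real.sqrt (5 ^ d)) (K₀ * Real.sqrt (9 ^ d)) / Real.sqrt (θ ^ d) +
            Real.sqrt (Fintype.card Cp) * (θ + 1) ^ 2 * (amax * Γ ^ 2 * Real.sqrt (Γ ^ d)) / (2 * c₀ ^ 2)) *
          (Real.sqrt (Fintype.card Cp) * Real.exp (κ * ((4 * d + 1) + 2 * d)) *
            ((L : ℝ) ^ A * Real.exp (Real.log L / R * (4 * d + 1))) * (L : ℝ) ^ A * Real.sqrt (((L : ℝ) ^ A) ^ d) /
            (C - 2 * d * cmax ^ 2 * κ ^ 2 - amax * (Real.exp (2 * d * κ) - 1))) +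
          Real.sqrt (Fintype.card Cp) * (θ + 1) ^ 2 / (2 * c₀ ^ 2) *
            Real.exp ((κ - (1 + d / 2) * (Real.log L / R)) * ((4 * d + 1) + 2 * d))) *
        (siteScale S hS hdivS lvl zc hcover p.1 : ℝ) ^ 2 *
        Real.exp (-((κ - (1 + d / 2) * (Real.log L / R)) *
          sdist bsrc btgt (siteScale S hS hdivS lvl zc hcover) p.1 (ctrU N (S (lvl k')) (zc k')))) * m := by
  have hC1 : 1 ≤ max (Real.sqrt (5 ^ d)) (K₀ * Real.sqrt (9 ^ d)) :=
    le_max_of_le_left (by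
      rw [show (1 : ℝ) = Real.sqrt 1 from Real.sqrt_one.symm]
      exact Real.sqrt_le_sqrt (one_le_pow₀ (by norm_num)))
  exact real_sup_levelOp_inverse_le_of_meanValueL2 S hS hdivS lvl zc hdisj hcover Rm hRm T hT a ha ω hsupp hamax hscale c hcc hc₀
    hL e hSe hR hadd hc hcoer hκ0 hκ1 hμ hrate hΓ hθ hC1 (l2binder_of_roomy hK₀ hMVroomy) k' u hu hm hum p

/-- **THE SUP MEMBER FOR `levelOp` FROM A ROOMY L¹ KERNEL BINDER (room `10r + 4 ≤ N_μ` — the announced shape of beta-d4-p2's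
`SubsolutionMeanValueL1.hMV_holds`).**  File 16c's `real_sup_levelOp_inverse_le_of_meanValue` with `C_MV = max(11^d, K·7^d)` via
`l1binder_of_roomy10`: the sup member (3.42)₁'s SHAPE for `levelOp`, sitewise and level-free, from that binder ALONE — so the
moment the roomy L¹ binder is a kernel theorem, O.2 item (ii-b) for the MODEL is CLOSED by one instantiation (`hMV10 := hMV_holds`).
[cite: Balaban1985BackgroundPropagators, Thm 3.1 (3.42) p.397] [folklore] -/
theorem real_sup_levelOp_inverse_le_of_roomy10 {cmax : ℝ} (hc : ∀ b, |c b| ≤ cmax) {C : ℝ}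
    (hcoer : ∀ f : UT N × Cp → ℝ,
      C * ∑ k, ((S (lvl k) : ℝ) ^ 2)⁻¹ * ∑ v : Box d (S (lvl k)), ∑ i, f (cellPt S hS hdivS lvl zc k v, i) ^ 2 ≤
        ∑ p, f p * levelOp bsrc btgt c Rm (fun l x => ctrU N (S l) (tblk (hS l) (hdivS l) x))
          (fun l x => ω l (ctrU N (S l) (tblk (hS l) (hdivS l) x))) T a f p)
    {κ : ℝ} (hκ0 : 0 ≤ κ) (hκ1 : κ ≤ 1) (hμ : 0 < C - 2 * d * cmax ^ 2 * κ ^ 2 - amax * (Real.exp (2 * d * κ) - 1))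
    (hrate : (1 + d / 2) * (Real.log L / R) ≤ κ)
    {Γ θ : ℝ} (hΓ : Γ = (L : ℝ) ^ A * Real.exp (Real.log L / R * (4 * d + 1))) (hθ : θ = 1 / (4 * d * Γ)) {K₀ : ℝ}
    (hK₀ : 0 ≤ K₀)
    (hMV10 : ∀ (x₀ : UT N) (r : ℕ), (∀ μ, 10 * r + 4 ≤ N μ) → ∀ z : UT N → ℝ, (∀ y, 0 ≤ z y) →
      (∀ x, dist x x₀ ≤ r → 2 * d * z x ≤ ∑ μ, (z (up x μ) + z (dn x μ))) →
      z x₀ ≤ K₀ / (2 * r + 1 : ℝ) ^ d * ∑ x ∈ univ.filter (fun x : UT N => dist x x₀ ≤ r), z x)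
    (k' : K) (u : UT N × Cp → ℝ) (hu : ∀ p, cellOf S hS hdivS lvl zc hcover p.1 ≠ k' → u p = 0)
    {m : ℝ} (hm : 0 ≤ m) (hum : ∀ p, |u p| ≤ m) (p : UT N × Cp) :
    |(Ring.inverse (levelOp bsrc btgt c Rm (fun l x => ctrU N (S l) (tblk (hS l) (hdivS l) x))
        (fun l x => ω l (ctrU N (S l) (tblk (hS l) (hdivS l) x))) T a)) u p| ≤
      ((max ((11 : ℝ) ^ d) (K₀ * 7 ^ d) / Real.sqrt (θ ^ d) +
            Real.sqrt (Fintype.card Cp) * (θ + 1) ^ 2 * (amax * Γ ^ 2 * Real.sqrt (Γ ^ d)) / (2 * c₀ ^ 2)) *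
          (Real.sqrt (Fintype.card Cp) * Real.exp (κ * ((4 * d + 1) + 2 * d)) *
            ((L : ℝ) ^ A * Real.exp (Real.log L / R * (4 * d + 1))) * (L : ℝ) ^ A * Real.sqrt (((L : ℝ) ^ A) ^ d) /
            (C - 2 * d * cmax ^ 2 * κ ^ 2 - amax * (Real.exp (2 * d * κ) - 1))) +
          Real.sqrt (Fintype.card Cp) * (θ + 1) ^ 2 / (2 * c₀ ^ 2) *
            Real.exp ((κ - (1 + d / 2) * (Real.log L / R)) * ((4 * d + 1) + 2 * d))) *
        (siteScale S hS hdivS lvl zc hcover p.1 : ℝ) ^ 2 *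
        Real.exp (-((κ - (1 + d / 2) * (Real.log L / R)) *
          sdist bsrc btgt (siteScale S hS hdivS lvl zc hcover) p.1 (ctrU N (S (lvl k')) (zc k')))) * m := by
  have hC1 : 1 ≤ max ((11 : ℝ) ^ d) (K₀ * 7 ^ d) := le_max_of_le_left (one_le_pow₀ (by norm_num))
  exact real_sup_levelOp_inverse_le_of_meanValue S hS hdivS lvl zc hdisj hcover Rm hRm T hT a ha ω hsupp hamax hscale c hcc hc₀
    hL e hSe hR hadd hc hcoer hκ0 hκ1 hμ hrate hΓ hθ hC1 (l1binder_of_roomy10 hK₀ hMV10) k' u hu hm hum p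

end

end Summit.QuantumFields.BalabanUV.Beta.MeanValueBinderAdapter
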